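import Summits.Ventures.QEC.CircuitDistance.ETowerSound
import Summits.Ventures.QEC.CircuitDistance.PortK2Check
import HarnessLib

/-!
# P3-PORT STEP 2 (E-fold tower): BRIDGE lemmas — index FINSETS of the K2 checker of record versus the tower's NUMERAL words
# (CARD-7 §5 S7, PORT-SPEC S7; cell `qec`, experiment CDX, seat qec-cdx-type-1)

The K2 instance of record (`PortK2Check.K2Data`, `PortK2Bridge.K2Inst`) speaks of index finsets `ix ⊆ [0, N)` with parity
bits `D.synBit ix c` / `D.lgBit ix j` (odd counts); the tower speaks of numerals `u < 2^N` with `lin D.synOf N 0 u` /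
`lin D.lgOf N 0 u` (xor of masks).  `maskF ix = Σ_{n ∈ ix} 2^n` translates: `testBit_lin_maskF` (bit `c` of the xor = parity
of the count), hence `kerK D.synOf N (maskF ix) ↔ D.ZeroSyn ix`, `kerK D.lgOf N (maskF ix) ↔ ∀ j, D.lgBit ix j = false`,
`popc N (maskF ix) = #ix`, and the support of `maskF ix` is `ix`.  Generic in `D`; no data; no `native_decide`.
-/

namespace Summit.Ventures.QEC.CircuitDistance.ETower

open Summit.Ventures.QEC.Census Summit.Ventures.QEC.Census.Fold Finset

/-! ## Numeral of an index finset -/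

/-- The numeral with exactly the bits of `ix` set. -/
def maskF (ix : Finset ℕ) : ℕ := maskOf (ix.sort (· ≤ ·))

/-- Bits of `maskF`. -/
theorem testBit_maskF (ix : Finset ℕ) (i : ℕ) : (maskF ix).testBit i = decide (i ∈ ix) := by
  unfold maskF
  rw [testBit_maskOf_nodup _ (Finset.sort_nodup _ _)]
  simp only [Finset.mem_sort]

/-- `maskF` of a finset below `N` is below `2^N`. -/
theorem maskF_lt {ix : Finset ℕ} {N : ℕ} (hix : ∀ n ∈ ix, n < N) : maskF ix < 2 ^ N :=
  maskOf_lt _ _ fun j hj => hix j ((Finset.mem_sort _).1 hj)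

/-- The support of `maskF ix` (read on `N ≥` all members) is `ix`. -/
theorem bitsOf_maskF_toFinset {ix : Finset ℕ} {N : ℕ} (hix : ∀ n ∈ ix, n < N) : (bitsOf N 0 (maskF ix)).toFinset = ix := by
  ext n
  rw [List.mem_toFinset, mem_bitsOf_zero_iff, testBit_maskF, decide_eq_true_eq]
  exact ⟨fun h => h.2, fun h => ⟨hix n h, h⟩⟩

/-- Weight of `maskF ix` = `#ix`. -/
theorem popc_maskF {ix : Finset ℕ} {N : ℕ} (hix : ∀ n ∈ ix, n < N) : popc N (maskF ix) = #ix := by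
  rw [popc_eq_card]
  congr 1
  ext i
  simp only [mem_filter, mem_range, testBit_maskF, decide_eq_true_eq]
  exact ⟨fun h => h.2, fun h => ⟨hix i h, h⟩⟩

/-- Parity of an xor-sum: bit `c` of `⊕_{n ∈ L} g n` is the parity of the number of `n ∈ L` with bit `c` of `g n` set. -/
theorem testBit_xorIdx (g : ℕ → ℕ) (c : ℕ) : ∀ (L : List ℕ),
    (xorIdx g L).testBit c = decide (Odd (L.countP fun n => (g n).testBit c)) := by
  intro L
  induction L with
  | nil => simp [xorIdx]
  | cons n L ih =>
    rw [xorIdx, Nat.testBit_xor, ih, List.countP_cons]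
    by_cases hb : (g n).testBit c = true <;>
      by_cases ho : Odd (List.countP (fun n => (g n).testBit c) L) <;> simp [hb, ho, Nat.odd_add_one]

/-- Bit `c` of the `lin`-syndrome of `maskF ix` is the K2 parity bit (odd count over `ix`). -/
theorem testBit_lin_maskF (g : ℕ → ℕ) {ix : Finset ℕ} {N : ℕ} (hix : ∀ n ∈ ix, n < N) (c : ℕ) :
    (lin g N 0 (maskF ix)).testBit c = decide (Odd #(ix.filter fun n => (g n).testBit c)) := by
  unfold maskF
  have hL : ∀ j ∈ ix.sort (· ≤ ·), j < N := fun j hj => hix j ((Finset.mem_sort _).1 hj)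
  rw [← xorIdx_eq_lin _ _ _ hL, testBit_xorIdx]
  congr 2
  rw [List.countP_eq_length_filter, ← List.toFinset_card_of_nodup ((Finset.sort_nodup _ _).filter _), List.toFinset_filter,
    Finset.sort_toFinset]

/-- **Kernel of the syndrome table = zero syndrome of the index finset.** -/
theorem kerK_synOf_iff_zeroSyn (D : K2.K2Data) {ix : Finset ℕ} {N : ℕ} (hix : ∀ n ∈ ix, n < N) :
    kerK D.synOf N (maskF ix) ↔ D.ZeroSyn ix := by
  unfold kerK K2.K2Data.ZeroSyn K2.K2Data.synBit
  constructor
  · intro h c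
    have := testBit_lin_maskF D.synOf hix c
    rw [h, Nat.zero_testBit] at this
    rw [← this]
  · intro h
    apply Nat.eq_of_testBit_eq; intro c
    rw [testBit_lin_maskF D.synOf hix c, Nat.zero_testBit, h c]

/-- **Kernel of the logical table = all logical parities even.** -/
theorem kerK_lgOf_iff (D : K2.K2Data) {ix : Finset ℕ} {N : ℕ} (hix : ∀ n ∈ ix, n < N) :
    kerK D.lgOf N (maskF ix) ↔ ∀ j, D.lgBit ix j = false := by
  unfold kerK K2.K2Data.lgBit
  constructor
  · intro h j
    have := testBit_lin_maskF D.lgOf hix j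
    rw [h, Nat.zero_testBit] at this
    rw [← this]
  · intro h
    apply Nat.eq_of_testBit_eq; intro j
    rw [testBit_lin_maskF D.lgOf hix j, Nat.zero_testBit, h j]

end Summit.Ventures.QEC.CircuitDistance.ETower
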